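import Summits.QuantumFields.BalabanUV.T4Continuum.Support.NE3CovariantLift
import Summits.QuantumFields.BalabanUV.T4Continuum.Support.NE3SmoothLiftCurl
import Summits.QuantumFields.BalabanUV.T4Continuum.Support.NE3CurlOfGaugeDir
import Summits.QuantumFields.BalabanUV.T4Continuum.Support.NE3NearIdentityGradient
import Summits.QuantumFields.BalabanUV.T4Continuum.Support.NE3QbarIterCovLiftPrep
import Summits.QuantumFields.BalabanUV.T4Continuum.Support.NE3QbarGaugeCovariance
import Summits.QuantumFields.BalabanUV.T4Continuum.Support.NE3QbarNearFlat
import Summits.QuantumFields.BalabanUV.T4Continuum.Support.AveragingDeficitLocality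
import HarnessLib

/-!
# T⁴ programme, node NE3 — route Π, row Π-R (curved step), file Π-R-W6c¹: THE COVARIANT CURL OF THE TRANSPORTED LIFT, POINTWISE —
# `‖curl_W (covLift M W Φ) (x; μ,ν)‖ ≤ liftC·(1∕M² + 16(d+1)·x_W)·(‖Φ(blk x, μ)‖ + ‖Φ(blk x, ν)‖)`, k-FREE, LOCAL IN ONE BLOCK

NE3 (node U1b) formalisation swarm, leaf seat `b2b-balaban-t4-ne3-formalise-leaf-01` (gen 8); row Π-R-W; the pointwise input of the curl letters
(R2), (R3), (R6′) of ruling ρ-g25-1 (2).  THE IDEA (W3's `covLift = Ad_{liftHol}·smoothLift` read in THE LIFT'S OWN COMB GAUGE): in the comb ∕ axial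
gauge from the block corner `M•blk x` (`NE3CombGauge`: `gaugeAct (btree M W (blk x)) W`) the lift's transports `liftHol` are EXACTLY `1` on the block
(`hol_comb`, `btree_corner`, `treeWord (M•e_κ) = seg κ M`), so the transported lift IS the flat smooth lift of the (corner-rotated) coarse field on every
bond of the block, and the bonds of a plaquette based in the block that leave it carry ZERO lift (Π-R♭-4a `smoothLift_of_res_ne_eq_zero`: the profile
vanishes on block faces); the comb bonds of the plaquette are `|·|₁·x_W`-close to `1` (THIN STRIPS — the tree's `axial_bond_bound_sharp` through
`NE3CombGauge.norm_comb_sub_one_le`), so the covariant curl is Π-R♭-4b's FLAT curl `O(liftC∕M²)` (`NE3SmoothLiftCurl.norm_curlAt_flat_smoothLift_le`)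
plus `16·(dM)·x_W · liftC∕M = O(liftC·d·x_W)`; covariance of the dressed curl (`curlAt_gaugeAct`, all planes, algebraic twin of
`AveragingDeficitLocality.curl_gaugeAct`) and of the lift (W3 `covLift_gaugeAct`) carries the bound back to `W`.

CONTENT ([folklore]; 0 sorry; 0 def): §1 `curlAt_gaugeAct`, `curlAt_congr`; §2 the lift in its own comb gauge (`liftHol_comb_eq_one`,
`covLift_comb_eq_smoothLift`, `_step`); §3 the dressed curl at a near-flat background against the flat curl; §4 **`norm_curlAt_covLift_le`** and
its `Plaq` form **`norm_curl_covLift_le`**.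

HONEST FRAMING.  Kinematics of OUR objects; constants explicit and crude; the summed letters are the next file; nothing about minimisers; (P♮)_W, T-E_w and
**NE3 are NOT proved**; spine PROVED 0∕9; finite T⁴ rung (B)+1 — NOT infinite volume, NOT mass gap, NOT `BetaPertH`, NOT Clay.  PLACEMENT:
`Summits/QuantumFields/BalabanUV/`.  HONEST DEPENDENCY (cell page 1): continuum YM on T⁴ ⇐ BetaPertH ∧ nine spine estimates (0/9 proved); BetaPertH
⇐ (D1) ∧ (D4) ∧ CAP+tail; G-an2-4 gates asym, D1 and NE2/3/4.
-/

set_option autoImplicit false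

open scoped BigOperators Matrix.Norms.L2Operator
open Finset

namespace Summit.QuantumFields.BalabanUV.T4Continuum.NE3CovLiftCurl

open Literature.MathematicalPhysics.QuantumFieldTheory.Balaban1983to89
open B7Prop1Explicit B7Prop2Explicit
open T4AveragingDeficitWall (IsUnitaryCfg SmallField Ad curlAt curl)
open T4AveragingDeficitNonAbelian (Ad_mul Ad_sub)
open AveragingDeficitTransport (norm_Ad_of_unitary)
open AveragingDeficitNearIdentity (Ad_add Ad_one Ad_zero norm_Ad_sub_le)
open AveragingDeficitLocality (dirGauge)
open AveragingDeficitBlockDensity (btree bseg btree_mem l1_e)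
open BlockAveragePushDirSplit (flat)
open SmoothRefineBlocks (blk res blk_add_res res_nonneg res_le blk_add_e res_add_e_self)
open NE3CombGauge (isUnitaryCfg_comb btree_corner hol_comb norm_comb_sub_one_le)
open B8Lemma1NonAbelian (lowPart l1_lowPart_eq)
open NE3SmoothLiftFlat (smoothLift)
open NE3SmoothLiftBounds (norm_smoothLift_le smoothLift_of_res_ne_eq_zero)
open NE3SmoothLiftCurl (curlAt_flat_eq norm_curlAt_flat_smoothLift_le)
open NE3CovariantLift (liftHol covLift liftHol_gaugeAct covLift_gaugeAct)
open NE3QbarGaugeCovariance (Ad_mul_inv_Ad)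
open NE3QbarNearFlat (norm_units_inv_sub_one_le')
open NE3NearIdentityGradient (norm_mul_sub_one_le)
open NE3QbarIterCovLiftPrep (liftC liftC_nonneg)

noncomputable section

variable {d : ℕ} {n : Type*} [Fintype n] [DecidableEq n]

/-! ## §1 Covariance of the dressed curl on every plane; dependence on the four bonds only -/

/-- **COVARIANCE OF THE DRESSED CURL** (every ordered plane; fine fields dress at their endpoints, `dirGauge`):
`curlAt (W^u) (ψ^u) z μ ν = Ad_{u z} (curlAt W ψ z μ ν)`. [cite: Balaban1985Averaging, (11) p.19] -/
theorem curlAt_gaugeAct (u : Site d → (Matrix n n ℂ)ˣ) (V : Site d → Fin d → (Matrix n n ℂ)ˣ) (ψ : Site d → Fin d → Matrix n n ℂ)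
    (z : Site d) (μ ν : Fin d) : curlAt (gaugeAct u V) (dirGauge u ψ) z μ ν = Ad (u z) (curlAt V ψ z μ ν) := by
  have h1 : gaugeAct u V z μ = u z * V z μ * (u (z + e μ))⁻¹ := rfl
  have h2 : gaugeAct u V z μ * gaugeAct u V (z + e μ) ν = u z * (V z μ * V (z + e μ) ν) * (u (z + e μ + e ν))⁻¹ := by
    simp only [gaugeAct]; group
  have h3 : gaugeAct u V z μ * gaugeAct u V (z + e μ) ν * (gaugeAct u V (z + e ν) μ)⁻¹
      = u z * (V z μ * V (z + e μ) ν * (V (z + e ν) μ)⁻¹) * (u (z + e ν))⁻¹ := by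
    simp only [gaugeAct, add_right_comm z (e ν) (e μ)]; group
  unfold curlAt dirGauge
  rw [h3, h2, h1, add_right_comm z (e ν) (e μ), Ad_mul_inv_Ad, Ad_mul_inv_Ad, Ad_mul_inv_Ad, Ad_mul_inv_Ad]
  simp only [Ad_mul, Ad_add, Ad_sub]

/-- The dressed curl of a plaquette reads the direction field on its four bonds only. [folklore] -/
theorem curlAt_congr (V : Site d → Fin d → (Matrix n n ℂ)ˣ) {ψ ψ' : Site d → Fin d → Matrix n n ℂ} {x : Site d} {μ ν : Fin d}
    (h1 : ψ x μ = ψ' x μ) (h2 : ψ (x + e μ) ν = ψ' (x + e μ) ν) (h3 : ψ (x + e ν) μ = ψ' (x + e ν) μ) (h4 : ψ x ν = ψ' x ν) :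
    curlAt V ψ x μ ν = curlAt V ψ' x μ ν := by
  unfold curlAt; rw [h1, h2, h3, h4]

/-! ## §2 The lift in its own comb gauge is the flat smooth lift on the block -/

/-- The straight coarse-bond transport is the tree transport to the next corner: `btree M W z (M•(z + e_κ)) = bseg M W z κ`. [folklore] -/
theorem btree_next_corner (M : ℕ) (W : Site d → Fin d → (Matrix n n ℂ)ˣ) (z : Site d) (κ : Fin d) :
    btree M W z ((M : ℤ) • (z + e κ)) = bseg M W z κ := by
  unfold btree bseg
  rw [smul_add, add_sub_cancel_left, B8Lemma1NonAbelian.treeWord_zsmul_e]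

/-- **IN ITS OWN COMB GAUGE THE LIFT'S TRANSPORT IS TRIVIAL**: `liftHol M (W^{btree(blk x)}) x κ = 1`. [folklore] -/
theorem liftHol_comb_eq_one (M : ℕ) (W : Site d → Fin d → (Matrix n n ℂ)ˣ) (x : Site d) (κ : Fin d) :
    liftHol M (gaugeAct (btree M W (blk M x)) W) x κ = 1 := by
  rw [liftHol_gaugeAct, btree_next_corner]
  unfold liftHol
  group

/-- … hence on every bond of the block of `x` the transported lift is the flat smooth lift. [folklore] -/
theorem covLift_comb_eq_smoothLift (M : ℕ) (W : Site d → Fin d → (Matrix n n ℂ)ˣ) (Φ : Site d → Fin d → Matrix n n ℂ) {x y : Site d}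
    (hy : blk M y = blk M x) (κ : Fin d) : covLift M (gaugeAct (btree M W (blk M x)) W) Φ y κ = smoothLift M Φ y κ := by
  unfold covLift; rw [← hy, liftHol_comb_eq_one, Ad_one]

/-- … and on the transverse bonds one step beyond (in the block: the same; across the face: both sides vanish). [folklore] -/
theorem covLift_comb_eq_smoothLift_step {M : ℕ} (hM : 1 ≤ M) (W : Site d → Fin d → (Matrix n n ℂ)ˣ) (Φ : Site d → Fin d → Matrix n n ℂ)
    (x : Site d) {μ κ : Fin d} (hne : μ ≠ κ) :
    covLift M (gaugeAct (btree M W (blk M x)) W) Φ (x + e μ) κ = smoothLift M Φ (x + e μ) κ := by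
  by_cases h : res M x μ = (M : ℤ) - 1
  · have hres : res M (x + e μ) μ = 0 := by rw [res_add_e_self hM]; simp [h]
    unfold covLift
    rw [smoothLift_of_res_ne_eq_zero M Φ hne hres, Ad_zero]
  · have hblk : blk M (x + e μ) = blk M x := by rw [blk_add_e hM]; simp [h]
    exact covLift_comb_eq_smoothLift M W Φ hblk κ

/-- The flat smooth lift one transverse step on is still controlled by the datum of the block of `x` (zero across the face). [folklore] -/
theorem norm_smoothLift_step_pt_le {M : ℕ} (hM : 2 ≤ M) (hd : 1 ≤ d) (Φ : Site d → Fin d → Matrix n n ℂ) (x : Site d) {μ κ : Fin d}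
    (hne : μ ≠ κ) : ‖smoothLift M Φ (x + e μ) κ‖ ≤ liftC d / M * ‖Φ (blk M x) κ‖ := by
  have hM1 : 1 ≤ M := by omega
  by_cases h : res M x μ = (M : ℤ) - 1
  · have hres : res M (x + e μ) μ = 0 := by rw [res_add_e_self hM1]; simp [h]
    rw [smoothLift_of_res_ne_eq_zero M Φ hne hres, norm_zero]
    have := liftC_nonneg d; positivity
  · have hblk : blk M (x + e μ) = blk M x := by rw [blk_add_e hM1]; simp [h]
    rw [← hblk, liftC]; exact norm_smoothLift_le hM hd Φ _ κ

/-! ## §3 The dressed curl at a near-flat background against the flat curl -/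

/-- **NEAR-FLAT VS FLAT CURL, POINTWISE** (unitary `V`; the three transporting bonds `δ`-close to `1`; the four field values `≤ s`):
`‖curlAt V ψ x μ ν − curlAt 1 ψ x μ ν‖ ≤ 16·δ·s`. [folklore] -/
theorem norm_curlAt_sub_flat_le [Nonempty n] {V : Site d → Fin d → (Matrix n n ℂ)ˣ} (hV : IsUnitaryCfg V) (ψ : Site d → Fin d → Matrix n n ℂ)
    (x : Site d) (μ ν : Fin d) {δ s : ℝ} (hδ0 : 0 ≤ δ)
    (h1 : ‖((V x μ : (Matrix n n ℂ)ˣ) : Matrix n n ℂ) - 1‖ ≤ δ) (h2 : ‖((V (x + e μ) ν : (Matrix n n ℂ)ˣ) : Matrix n n ℂ) - 1‖ ≤ δ)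
    (h3 : ‖((V (x + e ν) μ : (Matrix n n ℂ)ˣ) : Matrix n n ℂ) - 1‖ ≤ δ)
    (ha : ‖ψ x μ‖ ≤ s) (hb : ‖ψ (x + e μ) ν‖ ≤ s) (hc : ‖ψ (x + e ν) μ‖ ≤ s) (hdd : ‖ψ x ν‖ ≤ s) :
    ‖curlAt V ψ x μ ν - curlAt (flat (d := d) (n := n)) ψ x μ ν‖ ≤ 16 * δ * s := by
  have hu1 := hV x μ
  have hu2 := hV (x + e μ) ν
  have hu3 := hV (x + e ν) μ
  have h12 : ‖((V x μ * V (x + e μ) ν : (Matrix n n ℂ)ˣ) : Matrix n n ℂ) - 1‖ ≤ 2 * δ := by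
    have := norm_mul_sub_one_le (V₁ := V x μ) hu2; linarith
  have h123 : ‖((V x μ * V (x + e μ) ν * (V (x + e ν) μ)⁻¹ : (Matrix n n ℂ)ˣ) : Matrix n n ℂ) - 1‖ ≤ 3 * δ := by
    have hinv := norm_units_inv_sub_one_le' hu3
    have := norm_mul_sub_one_le (V₁ := V x μ * V (x + e μ) ν) ((unitaryUnits _).inv_mem hu3)
    linarith
  have hm12 : (V x μ * V (x + e μ) ν) ∈ unitaryUnits (Matrix n n ℂ) := (unitaryUnits _).mul_mem hu1 hu2
  have hm123 : (V x μ * V (x + e μ) ν * (V (x + e ν) μ)⁻¹) ∈ unitaryUnits (Matrix n n ℂ) :=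
    (unitaryUnits _).mul_mem hm12 ((unitaryUnits _).inv_mem hu3)
  have hsplit : curlAt V ψ x μ ν - curlAt (flat (d := d) (n := n)) ψ x μ ν
      = (Ad (V x μ) (ψ x μ) - ψ x μ) + (Ad (V x μ * V (x + e μ) ν) (ψ (x + e μ) ν) - ψ (x + e μ) ν)
        - (Ad (V x μ * V (x + e μ) ν) (ψ (x + e ν) μ) - ψ (x + e ν) μ)
        - (Ad (V x μ * V (x + e μ) ν * (V (x + e ν) μ)⁻¹) (ψ x ν) - ψ x ν) := by
    rw [curlAt_flat_eq]; unfold curlAt; abel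
  rw [hsplit]
  have t1 := norm_Ad_sub_le hu1 (ψ x μ)
  have t2 := norm_Ad_sub_le hm12 (ψ (x + e μ) ν)
  have t3 := norm_Ad_sub_le hm12 (ψ (x + e ν) μ)
  have t4 := norm_Ad_sub_le hm123 (ψ x ν)
  have e1 : 2 * ‖((V x μ : (Matrix n n ℂ)ˣ) : Matrix n n ℂ) - 1‖ * ‖ψ x μ‖ ≤ 2 * δ * s :=
    mul_le_mul (mul_le_mul_of_nonneg_left h1 (by norm_num)) ha (norm_nonneg _) (by positivity)
  have e2 : 2 * ‖((V x μ * V (x + e μ) ν : (Matrix n n ℂ)ˣ) : Matrix n n ℂ) - 1‖ * ‖ψ (x + e μ) ν‖ ≤ 2 * (2 * δ) * s :=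
    mul_le_mul (mul_le_mul_of_nonneg_left h12 (by norm_num)) hb (norm_nonneg _) (by positivity)
  have e3 : 2 * ‖((V x μ * V (x + e μ) ν : (Matrix n n ℂ)ˣ) : Matrix n n ℂ) - 1‖ * ‖ψ (x + e ν) μ‖ ≤ 2 * (2 * δ) * s :=
    mul_le_mul (mul_le_mul_of_nonneg_left h12 (by norm_num)) hc (norm_nonneg _) (by positivity)
  have e4 : 2 * ‖((V x μ * V (x + e μ) ν * (V (x + e ν) μ)⁻¹ : (Matrix n n ℂ)ˣ) : Matrix n n ℂ) - 1‖ * ‖ψ x ν‖ ≤ 2 * (3 * δ) * s :=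
    mul_le_mul (mul_le_mul_of_nonneg_left h123 (by norm_num)) hdd (norm_nonneg _) (by positivity)
  calc _ ≤ ‖(Ad (V x μ) (ψ x μ) - ψ x μ) + (Ad (V x μ * V (x + e μ) ν) (ψ (x + e μ) ν) - ψ (x + e μ) ν)
            - (Ad (V x μ * V (x + e μ) ν) (ψ (x + e ν) μ) - ψ (x + e ν) μ)‖
          + ‖Ad (V x μ * V (x + e μ) ν * (V (x + e ν) μ)⁻¹) (ψ x ν) - ψ x ν‖ := norm_sub_le _ _
    _ ≤ (‖(Ad (V x μ) (ψ x μ) - ψ x μ) + (Ad (V x μ * V (x + e μ) ν) (ψ (x + e μ) ν) - ψ (x + e μ) ν)‖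
          + ‖Ad (V x μ * V (x + e μ) ν) (ψ (x + e ν) μ) - ψ (x + e ν) μ‖)
          + ‖Ad (V x μ * V (x + e μ) ν * (V (x + e ν) μ)⁻¹) (ψ x ν) - ψ x ν‖ := by gcongr; exact norm_sub_le _ _
    _ ≤ ((‖Ad (V x μ) (ψ x μ) - ψ x μ‖ + ‖Ad (V x μ * V (x + e μ) ν) (ψ (x + e μ) ν) - ψ (x + e μ) ν‖)
          + ‖Ad (V x μ * V (x + e μ) ν) (ψ (x + e ν) μ) - ψ (x + e ν) μ‖)
          + ‖Ad (V x μ * V (x + e μ) ν * (V (x + e ν) μ)⁻¹) (ψ x ν) - ψ x ν‖ := by gcongr; exact norm_add_le _ _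
    _ ≤ 16 * δ * s := by linarith

/-! ## §4 The covariant curl of the transported lift -/

omit [Fintype n] [DecidableEq n] in
/-- The block corner lies below every site of its block: `M•blk M x ≤ x`. [folklore] -/
theorem smul_blk_le {M : ℕ} (hM : 1 ≤ M) (x : Site d) : (M : ℤ) • blk M x ≤ x := by
  intro i
  have h := congr_fun (blk_add_res M x) i
  have h0 := res_nonneg hM x i
  simp only [Pi.add_apply, Pi.smul_apply, smul_eq_mul] at h ⊢
  linarith

omit [Fintype n] [DecidableEq n] in
/-- `|x − M•blk M x|₁ ≤ d·(M − 1)` (the offsets lie in `[0, M)`). [folklore] -/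
theorem l1_sub_smul_blk_le {M : ℕ} (hM : 1 ≤ M) (x : Site d) : l1 (x - (M : ℤ) • blk M x) ≤ d * (M - 1) := by
  have hres : x - (M : ℤ) • blk M x = res M x := by rw [sub_eq_iff_eq_add, add_comm]; exact (blk_add_res M x).symm
  rw [hres]
  unfold l1
  calc ∑ κ : Fin d, (res M x κ).natAbs ≤ ∑ _κ : Fin d, (M - 1) := Finset.sum_le_sum fun κ _ => by
          have h0 := res_nonneg hM x κ
          have h1 := res_le hM x κ
          have : ((res M x κ).natAbs : ℤ) ≤ (M : ℤ) - 1 := by rw [Int.natAbs_of_nonneg h0]; exact h1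
          omega
    _ = d * (M - 1) := by rw [Finset.sum_const, Finset.card_univ, Fintype.card_fin, smul_eq_mul]

/-- **THE COMB BONDS OF A PLAQUETTE BASED IN THE BLOCK ARE NEAR THE IDENTITY**: for `y ∈ {x, x + e_α}`,
`‖(W^{btree(blk x)})(y, μ) − 1‖ ≤ (d·(M−1) + 1)·x_W` (thin strips: `NE3CombGauge.norm_comb_sub_one_le`). [cite: Balaban1985Averaging, pp.24–25] -/
theorem norm_comb_plaquette_bond_le [Nonempty n] {M : ℕ} (hM : 1 ≤ M) {W : Site d → Fin d → (Matrix n n ℂ)ˣ} (hWu : IsUnitaryCfg W)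
    {a : ℝ} (ha : 0 ≤ a) (hWa : SmallField W a) (x : Site d) (μ : Fin d) (t : Site d) (ht0 : 0 ≤ t) (ht1 : l1 t ≤ 1) :
    ‖((gaugeAct (btree M W (blk M x)) W (x + t) μ : (Matrix n n ℂ)ˣ) : Matrix n n ℂ) - 1‖ ≤ ((d : ℝ) * ((M : ℝ) - 1) + 1) * a := by
  have hle : (M : ℤ) • blk M x ≤ x + t := fun i => by
    have h1 := smul_blk_le hM x i; have h2 := ht0 i; simp only [Pi.add_apply, Pi.zero_apply] at h2 ⊢; linarith
  refine (norm_comb_sub_one_le hWu hWa (blk M x) hle μ).trans (mul_le_mul_of_nonneg_right ?_ ha)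
  have hlow : l1 (lowPart μ (x + t - (M : ℤ) • blk M x)) ≤ l1 (x + t - (M : ℤ) • blk M x) := by
    rw [l1_lowPart_eq]; unfold l1
    exact Finset.sum_le_sum fun κ _ => by split_ifs <;> simp
  have htri : l1 (x + t - (M : ℤ) • blk M x) ≤ d * (M - 1) + 1 := by
    have h := l1_add_le (x - (M : ℤ) • blk M x) t
    rw [show x - (M : ℤ) • blk M x + t = x + t - (M : ℤ) • blk M x by abel] at h
    have := l1_sub_smul_blk_le hM x (d := d)
    omega
  have hcast : ((l1 (lowPart μ (x + t - (M : ℤ) • blk M x)) : ℕ) : ℝ) ≤ ((d * (M - 1) + 1 : ℕ) : ℝ) := by exact_mod_cast hlow.trans htri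
  refine hcast.trans (le_of_eq ?_)
  have hM' : ((M - 1 : ℕ) : ℝ) = (M : ℝ) - 1 := by rw [Nat.cast_sub hM]; simp
  push_cast [Nat.cast_sub hM]; ring

/-- **THE COVARIANT CURL OF THE TRANSPORTED LIFT, POINTWISE** (`M ≥ 2`, unitary `W` with `SmallField W x_W`): on every ordered plane `μ ≠ ν`,
`‖curlAt W (covLift M W Φ) x μ ν‖ ≤ liftC·(1∕M² + 16(d+1)·x_W)·(‖Φ(blk x, μ)‖ + ‖Φ(blk x, ν)‖)`. [folklore] -/
theorem norm_curlAt_covLift_le [Nonempty n] {M : ℕ} (hM : 2 ≤ M) {W : Site d → Fin d → (Matrix n n ℂ)ˣ} (hWu : IsUnitaryCfg W)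
    {a : ℝ} (ha : 0 ≤ a) (hWa : SmallField W a) (Φ : Site d → Fin d → Matrix n n ℂ) (x : Site d) {μ ν : Fin d} (hμν : μ ≠ ν) :
    ‖curlAt W (covLift M W Φ) x μ ν‖
      ≤ liftC d * (1 / (M : ℝ) ^ 2 + 16 * ((d : ℝ) + 1) * a) * (‖Φ (blk M x) μ‖ + ‖Φ (blk M x) ν‖) := by
  have hM1 : 1 ≤ M := by omega
  have hd : 1 ≤ d := μ.pos
  have hM0 : (0 : ℝ) < (M : ℝ) := by exact_mod_cast (show 0 < M by omega)
  -- the comb gauge of the block and the corner-rotated coarse field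
  set g : Site d → (Matrix n n ℂ)ˣ := btree M W (blk M x) with hg
  set Wc : Site d → Fin d → (Matrix n n ℂ)ˣ := gaugeAct g W with hWc
  set Φg : Site d → Fin d → Matrix n n ℂ := fun z' κ => Ad (g ((M : ℤ) • (z' + e κ))) (Φ z' κ) with hΦg
  have hgu : ∀ y, g y ∈ unitaryUnits (Matrix n n ℂ) := fun y => btree_mem hWu M _ y
  have hWcu : IsUnitaryCfg Wc := isUnitaryCfg_comb hWu M _
  have hΦgn : ∀ (z' : Site d) (κ : Fin d), ‖Φg z' κ‖ = ‖Φ z' κ‖ := fun z' κ => norm_Ad_of_unitary (hgu _) _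
  -- covariance: the curl at `W` is the conjugate of the curl in the comb gauge
  have hcov : covLift M Wc Φg = dirGauge g (covLift M W Φ) := by rw [hWc, hΦg, covLift_gaugeAct]; rfl
  have hcurl : curlAt Wc (covLift M Wc Φg) x μ ν = Ad (g x) (curlAt W (covLift M W Φ) x μ ν) := by rw [hcov, hWc, curlAt_gaugeAct]
  have hnorm : ‖curlAt W (covLift M W Φ) x μ ν‖ = ‖curlAt Wc (covLift M Wc Φg) x μ ν‖ := by rw [hcurl, norm_Ad_of_unitary (hgu x)]
  -- in the comb gauge the lift is the flat smooth lift on the four bonds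
  have hplaq : curlAt Wc (covLift M Wc Φg) x μ ν = curlAt Wc (smoothLift M Φg) x μ ν :=
    curlAt_congr Wc (covLift_comb_eq_smoothLift M W Φg rfl μ) (covLift_comb_eq_smoothLift_step hM1 W Φg x hμν)
      (covLift_comb_eq_smoothLift_step hM1 W Φg x (Ne.symm hμν)) (covLift_comb_eq_smoothLift M W Φg rfl ν)
  rw [hnorm, hplaq]
  -- sizes: the four field values and the three comb bonds
  set S : ℝ := ‖Φ (blk M x) μ‖ + ‖Φ (blk M x) ν‖ with hS
  have hS0 : 0 ≤ S := by positivity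
  have hs0 : 0 ≤ liftC d / M * S := by have := liftC_nonneg d; positivity
  have hvμ : ‖Φg (blk M x) μ‖ ≤ S := by rw [hΦgn]; linarith [norm_nonneg (Φ (blk M x) ν)]
  have hvν : ‖Φg (blk M x) ν‖ ≤ S := by rw [hΦgn]; linarith [norm_nonneg (Φ (blk M x) μ)]
  have hc0 : 0 ≤ liftC d / M := by have := liftC_nonneg d; positivity
  have ha' : ‖smoothLift M Φg x μ‖ ≤ liftC d / M * S := by
    have h := norm_smoothLift_le hM hd Φg x μ
    rw [← liftC] at h
    exact h.trans (mul_le_mul_of_nonneg_left hvμ hc0)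
  have hb' : ‖smoothLift M Φg (x + e μ) ν‖ ≤ liftC d / M * S :=
    (norm_smoothLift_step_pt_le hM hd Φg x hμν).trans (mul_le_mul_of_nonneg_left hvν hc0)
  have hc' : ‖smoothLift M Φg (x + e ν) μ‖ ≤ liftC d / M * S :=
    (norm_smoothLift_step_pt_le hM hd Φg x (Ne.symm hμν)).trans (mul_le_mul_of_nonneg_left hvμ hc0)
  have hd' : ‖smoothLift M Φg x ν‖ ≤ liftC d / M * S := by
    have h := norm_smoothLift_le hM hd Φg x ν
    rw [← liftC] at h
    exact h.trans (mul_le_mul_of_nonneg_left hvν hc0)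
  set δ : ℝ := ((d : ℝ) * ((M : ℝ) - 1) + 1) * a with hδ
  have hδ0 : 0 ≤ δ := by
    rw [hδ]; have : (1 : ℝ) ≤ M := by exact_mod_cast hM1
    have : 0 ≤ (d : ℝ) * ((M : ℝ) - 1) + 1 := by positivity
    positivity
  have he0 : (0 : Site d) ≤ 0 ∧ l1 (0 : Site d) ≤ 1 := ⟨le_rfl, by unfold l1; simp⟩
  have heα : ∀ α : Fin d, (0 : Site d) ≤ e α ∧ l1 (e α : Site d) ≤ 1 := fun α =>
    ⟨fun i => by simp only [Pi.zero_apply, e_apply]; split_ifs <;> norm_num, by rw [l1_e]⟩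
  have h1 : ‖((Wc x μ : (Matrix n n ℂ)ˣ) : Matrix n n ℂ) - 1‖ ≤ δ := by
    have h := norm_comb_plaquette_bond_le hM1 hWu ha hWa x μ 0 he0.1 he0.2; rw [add_zero] at h; exact h
  have h2 : ‖((Wc (x + e μ) ν : (Matrix n n ℂ)ˣ) : Matrix n n ℂ) - 1‖ ≤ δ := norm_comb_plaquette_bond_le hM1 hWu ha hWa x ν (e μ) (heα μ).1 (heα μ).2
  have h3 : ‖((Wc (x + e ν) μ : (Matrix n n ℂ)ˣ) : Matrix n n ℂ) - 1‖ ≤ δ := norm_comb_plaquette_bond_le hM1 hWu ha hWa x μ (e ν) (heα ν).1 (heα ν).2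
  have hnear := norm_curlAt_sub_flat_le hWcu (smoothLift M Φg) x μ ν hδ0 h1 h2 h3 ha' hb' hc' hd'
  have hflat : ‖curlAt (flat (d := d) (n := n)) (smoothLift M Φg) x μ ν‖ ≤ liftC d / (M : ℝ) ^ 2 * S := by
    have h := norm_curlAt_flat_smoothLift_le hM hd Φg x hμν
    rw [hΦgn, hΦgn, ← liftC] at h
    refine h.trans (le_of_eq ?_); rw [hS]; ring
  -- assemble: `16·δ·(liftC∕M)·S ≤ 16(d+1)·a·liftC·S` since `(d(M−1)+1)∕M ≤ d+1`
  have hδM : δ / M ≤ ((d : ℝ) + 1) * a := by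
    rw [hδ, div_le_iff₀ hM0]
    have h1M : (1 : ℝ) ≤ M := by exact_mod_cast hM1
    have hd0 : (0 : ℝ) ≤ d := Nat.cast_nonneg d
    nlinarith [mul_nonneg hd0 ha, mul_nonneg (sub_nonneg.2 h1M) ha]
  calc ‖curlAt Wc (smoothLift M Φg) x μ ν‖
      ≤ ‖curlAt (flat (d := d) (n := n)) (smoothLift M Φg) x μ ν‖
          + ‖curlAt Wc (smoothLift M Φg) x μ ν - curlAt (flat (d := d) (n := n)) (smoothLift M Φg) x μ ν‖ := by
        have := norm_add_le (curlAt (flat (d := d) (n := n)) (smoothLift M Φg) x μ ν)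
          (curlAt Wc (smoothLift M Φg) x μ ν - curlAt (flat (d := d) (n := n)) (smoothLift M Φg) x μ ν)
        rwa [add_sub_cancel] at this
    _ ≤ liftC d / (M : ℝ) ^ 2 * S + 16 * δ * (liftC d / M * S) := add_le_add hflat hnear
    _ = liftC d * (1 / (M : ℝ) ^ 2) * S + 16 * (δ / M) * (liftC d * S) := by field_simp
    _ ≤ liftC d * (1 / (M : ℝ) ^ 2) * S + 16 * (((d : ℝ) + 1) * a) * (liftC d * S) := by
        have : 0 ≤ liftC d * S := mul_nonneg (liftC_nonneg d) hS0
        nlinarith [mul_le_mul_of_nonneg_right hδM this]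
    _ = liftC d * (1 / (M : ℝ) ^ 2 + 16 * ((d : ℝ) + 1) * a) * S := by ring

/-- **… on indexed plaquettes**: `‖curl W (covLift M W Φ) (x, π)‖ ≤ liftC·(1∕M² + 16(d+1)·x_W)·(‖Φ(blk x, π₁)‖ + ‖Φ(blk x, π₂)‖)`. [folklore] -/
theorem norm_curl_covLift_le [Nonempty n] {M : ℕ} (hM : 2 ≤ M) {W : Site d → Fin d → (Matrix n n ℂ)ˣ} (hWu : IsUnitaryCfg W)
    {a : ℝ} (ha : 0 ≤ a) (hWa : SmallField W a) (Φ : Site d → Fin d → Matrix n n ℂ) (p : T4AveragingDeficitWall.Plaq d) :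
    ‖curl W (covLift M W Φ) p‖
      ≤ liftC d * (1 / (M : ℝ) ^ 2 + 16 * ((d : ℝ) + 1) * a) * (‖Φ (blk M p.1) p.2.1.1‖ + ‖Φ (blk M p.1) p.2.1.2‖) :=
  norm_curlAt_covLift_le hM hWu ha hWa Φ p.1 (ne_of_lt p.2.2)

end

end Summit.QuantumFields.BalabanUV.T4Continuum.NE3CovLiftCurl
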